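import Summits.Ventures.PercRepro.C025ProfileOneFlatRowsArith

/-!
# EVERY ROW `(q,u)` OF (Π) ON `U_{s,k} ⊕ U_{m,m}` — THE ARITHMETIC CORE, PART 2: THE INJECTION (night-3 g25)

`proofs/NIGHT3-G25-GRADED.md` §5.  `sources_le_slots`: the weighted sum over the active sources `(I, D)` is at most the
weighted sum over the slots `(J, Q)`, by the explicit weight-monotone injection Ψ — (G1) `(I, D) ↦ (I ∪ D, I)` when
`#I + #D ≤ s`; (G2) `(I, ∅) ↦ (I, J₀ I)` when `#I > s`; and for the bad sources (`min(#I,s) + #D > s`): (H) `(F ∖ I, J₀(F∖I) ∖ D)`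
when `#(F ∖ I) > s`, else (L2) `(I ∪ D, J₀(I ∪ D) ∖ D)` when the slot `(F ∖ I, F ∖ I ∖ D)` is the good image of an active
source, else (L1) that slot itself — with the decoding map Φ (`Φ (Ψ σ) = σ`) proving injectivity and every weight inequality an
instance of `choose_mul_choose_le_add`, the price threshold `u ≤ p_I` entering only there.  `rows_arith` assembles the
type-count inequality over `Fin k`.  No `def`, no `instance`, no notation.  Axioms: standard.
-/

namespace PercRepro

namespace OneFlat

open Finset

variable {α : Type} [DecidableEq α]

/-- **THE CHAIN-ACCOUNTING INEQUALITY (3a) ≤ (3b)**: the active sources `(I, D)` (`D ⊆ J₀(F ∖ I)`, `min(#I,s) ≤ q`,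
`#D ≤ u − q`, `u ≤ min(#(F∖I),s) + (m − (q − min(#I,s)))`) with weight `C(m, u − c_I − #D)·C(u − c_I − #D, q − c_I)` against
the slots `(J, Q)` (`Q ⊆ J₀(J)`, `min(#J,s) ≤ u`, `#Q ≤ q`) with weight `C(m, u − c_J)·C(u − c_J, q − #Q)`, for any basis
selector `J₀` (`J₀ J ⊆ J`, `#J₀ J = min(#J, s)`) — by the weight-monotone injection Ψ of NIGHT3-G25-GRADED.md §5. -/
theorem sources_le_slots (F : Finset α) (s m q u : ℕ) (hqu : q ≤ u)
    (J₀ : Finset α → Finset α) (hJ₀ : ∀ J, J₀ J ⊆ J ∧ (J₀ J).card = min J.card s) :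
    ∑ σ ∈ (F.powerset ×ˢ F.powerset).filter (fun σ : Finset α × Finset α =>
        σ.2 ⊆ J₀ (F \ σ.1) ∧ min σ.1.card s ≤ q ∧ σ.2.card ≤ u - q ∧
          u ≤ min (F \ σ.1).card s + (m - (q - min σ.1.card s))),
        m.choose (u - min σ.1.card s - σ.2.card) * (u - min σ.1.card s - σ.2.card).choose (q - min σ.1.card s) ≤
      ∑ τ ∈ (F.powerset ×ˢ F.powerset).filter (fun τ : Finset α × Finset α =>
        τ.2 ⊆ J₀ τ.1 ∧ min τ.1.card s ≤ u ∧ τ.2.card ≤ q),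
        m.choose (u - min τ.1.card s) * (u - min τ.1.card s).choose (q - τ.2.card) := by
  set SRC := (F.powerset ×ˢ F.powerset).filter (fun σ : Finset α × Finset α =>
        σ.2 ⊆ J₀ (F \ σ.1) ∧ min σ.1.card s ≤ q ∧ σ.2.card ≤ u - q ∧
          u ≤ min (F \ σ.1).card s + (m - (q - min σ.1.card s))) with hSRC
  set SLOT := (F.powerset ×ˢ F.powerset).filter (fun τ : Finset α × Finset α =>
        τ.2 ⊆ J₀ τ.1 ∧ min τ.1.card s ≤ u ∧ τ.2.card ≤ q) with hSLOT
  set wS : Finset α × Finset α → ℕ := fun σ =>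
    m.choose (u - min σ.1.card s - σ.2.card) * (u - min σ.1.card s - σ.2.card).choose (q - min σ.1.card s) with hwS
  set wT : Finset α × Finset α → ℕ := fun τ =>
    m.choose (u - min τ.1.card s) * (u - min τ.1.card s).choose (q - τ.2.card) with hwT
  set Ψ : Finset α × Finset α → Finset α × Finset α := fun σ =>
    if σ.1.card + σ.2.card ≤ s then (σ.1 ∪ σ.2, σ.1)
    else if σ.2 = ∅ then (σ.1, J₀ σ.1)
    else if s < (F \ σ.1).card then (F \ σ.1, J₀ (F \ σ.1) \ σ.2)
    else if Prod.mk ((F \ σ.1) \ σ.2) σ.2 ∈ SRC then (σ.1 ∪ σ.2, J₀ (σ.1 ∪ σ.2) \ σ.2)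
    else (F \ σ.1, (F \ σ.1) \ σ.2) with hΨ
  -- the decoding map (a left inverse of Ψ on the sources)
  set Φ : Finset α × Finset α → Finset α × Finset α := fun τ =>
    if τ.1.card ≤ s then (if Prod.mk τ.2 (τ.1 \ τ.2) ∈ SRC then (τ.2, τ.1 \ τ.2) else (F \ τ.1, τ.1 \ τ.2))
    else if s ≤ τ.2.card then (τ.1, ∅)
    else if s < (F \ τ.1).card + (J₀ τ.1 \ τ.2).card then (F \ τ.1, J₀ τ.1 \ τ.2)
    else (τ.1 \ (J₀ τ.1 \ τ.2), J₀ τ.1 \ τ.2) with hΦ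
  have hmem : ∀ σ ∈ SRC, σ.1 ⊆ F ∧ σ.2 ⊆ F ∧ σ.2 ⊆ J₀ (F \ σ.1) ∧ min σ.1.card s ≤ q ∧ σ.2.card ≤ u - q ∧
      u ≤ min (F \ σ.1).card s + (m - (q - min σ.1.card s)) := by
    intro σ hσ
    rw [hSRC, mem_filter, mem_product, mem_powerset, mem_powerset] at hσ
    exact ⟨hσ.1.1, hσ.1.2, hσ.2.1, hσ.2.2.1, hσ.2.2.2.1, hσ.2.2.2.2⟩
  have hmaps : ∀ σ ∈ SRC, Ψ σ ∈ SLOT ∧ wS σ ≤ wT (Ψ σ) ∧ Φ (Ψ σ) = σ := by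
    rintro ⟨I, D⟩ hσ
    obtain ⟨hI, hD, hDK, hcq, hDd, hact⟩ := hmem ⟨I, D⟩ hσ
    simp only at hI hD hDK hcq hDd hact
    have hK := hJ₀ (F \ I)
    have hDFI : D ⊆ F \ I := hDK.trans hK.1
    have hdisj : Disjoint I D := (subset_sdiff.1 hDFI).2.symm
    have hcardU : (I ∪ D).card = I.card + D.card := card_union_of_disjoint hdisj
    have hFI : (F \ I).card = F.card - I.card := card_sdiff_of_subset hI
    have hIF : I.card ≤ F.card := card_le_card hI
    have hDFIc : D.card ≤ (F \ I).card := card_le_card hDFI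
    have hFFI : F \ (F \ I) = I := Finset.sdiff_sdiff_eq_self hI
    have hslot : ∀ J Q : Finset α, J ⊆ F → Q ⊆ J₀ J → min J.card s ≤ u → Q.card ≤ q → (J, Q) ∈ SLOT := by
      intro J Q hJ hQ h1 h2
      rw [hSLOT, mem_filter, mem_product, mem_powerset, mem_powerset]
      exact ⟨⟨hJ, (hQ.trans (hJ₀ J).1).trans hJ⟩, hQ, h1, h2⟩
    -- the weight of a source, and the bad-case bound
    have hwS0 : ¬ (q - min I.card s ≤ m) → wS (I, D) = 0 := by
      intro h
      simp only [hwS]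
      rw [Nat.choose_eq_zero_of_lt (by omega), zero_mul]
    simp only [hΨ]
    split_ifs with h1 h2 h3 h4
    · -- (G1)
      have hIs : I.card ≤ s := by omega
      have hJU := hJ₀ (I ∪ D)
      have hJUeq : J₀ (I ∪ D) = I ∪ D :=
        eq_of_subset_of_card_le hJU.1 (by rw [hJU.2]; omega)
      refine ⟨hslot _ _ (union_subset hI hD) (by rw [hJUeq]; exact subset_union_left) (by omega) (by omega), ?_, ?_⟩
      · simp only [hwS, hwT]
        have e1 : min I.card s = I.card := min_eq_left hIs
        have e2 : min (I ∪ D).card s = I.card + D.card := by rw [hcardU]; exact min_eq_left h1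
        rw [e1, e2, Nat.sub_sub]
      · simp only [hΦ]
        rw [if_pos (by omega), union_sdiff_cancel_left hdisj, if_pos hσ]
    · -- (G2)
      subst h2
      have hIs : s < I.card := by simpa using h1
      have hJI := hJ₀ I
      have hcI : min I.card s = s := min_eq_right hIs.le
      refine ⟨hslot _ _ hI (subset_refl _) (by omega) (by rw [hJI.2]; omega), ?_, ?_⟩
      · simp only [hwS, hwT]
        rw [hcI, hJI.2, hcI, card_empty, Nat.sub_zero]
      · simp only [hΦ]
        rw [if_neg (by omega), if_pos (by rw [hJI.2, hcI])]
    · -- (H)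
      have hDne : D.Nonempty := nonempty_iff_ne_empty.2 h2
      have hDpos : 0 < D.card := card_pos.2 hDne
      have hKc : (J₀ (F \ I)).card = s := by rw [hK.2]; exact min_eq_right h3.le
      have hDs : D.card ≤ s := by rw [← hKc]; exact card_le_card hDK
      have hQc : (J₀ (F \ I) \ D).card = s - D.card := by rw [card_sdiff_of_subset hDK, hKc]
      have hmin : min (F \ I).card s = s := min_eq_right h3.le
      refine ⟨hslot _ _ sdiff_subset sdiff_subset (by omega) (by omega), ?_, ?_⟩
      · by_cases hqm : q - min I.card s ≤ m
        · simp only [hwS, hwT]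
          rw [hmin, hQc]
          have key := choose_mul_choose_le_add (m := m) (a := u - min I.card s - D.card)
            (b := q - min I.card s) (L := min I.card s + D.card - s) (by omega) (by omega)
          have ea : u - min I.card s - D.card + (min I.card s + D.card - s) = u - s := by omega
          have eb : q - min I.card s + (min I.card s + D.card - s) = q - (s - D.card) := by omega
          rw [ea, eb] at key
          exact key
        · rw [hwS0 hqm]; exact Nat.zero_le _
      · simp only [hΦ]
        rw [if_neg (by omega), if_neg (by omega), if_pos (by rw [hFFI, Finset.sdiff_sdiff_eq_self hDK]; omega), hFFI,
          Finset.sdiff_sdiff_eq_self hDK]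
    · -- (L2)
      have hDne : D.Nonempty := nonempty_iff_ne_empty.2 h2
      have hDpos : 0 < D.card := card_pos.2 hDne
      have hFIs : (F \ I).card ≤ s := by omega
      obtain ⟨-, -, hDK', -, -, -⟩ := hmem _ h4
      have hFF : F \ ((F \ I) \ D) = I ∪ D := by
        ext x
        simp only [mem_sdiff, mem_union, not_and, not_not]
        constructor
        · rintro ⟨hxF, hx⟩
          by_cases hxI : x ∈ I
          · exact Or.inl hxI
          · exact Or.inr (hx ⟨hxF, hxI⟩)
        · rintro (hxI | hxD)
          · exact ⟨hI hxI, fun h => absurd hxI h.2⟩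
          · exact ⟨hD hxD, fun _ => hxD⟩
      simp only at hDK'
      rw [hFF] at hDK'
      have hJU := hJ₀ (I ∪ D)
      have hJUc : (J₀ (I ∪ D)).card = s := by rw [hJU.2, hcardU]; exact min_eq_right (by omega)
      have hDs : D.card ≤ s := by rw [← hJUc]; exact card_le_card hDK'
      have hQc : (J₀ (I ∪ D) \ D).card = s - D.card := by rw [card_sdiff_of_subset hDK', hJUc]
      have hmin : min (I ∪ D).card s = s := by rw [hcardU]; exact min_eq_right (by omega)
      have hminFI : min (F \ I).card s = (F \ I).card := min_eq_left hFIs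
      refine ⟨hslot _ _ (union_subset hI hD) sdiff_subset (by omega) (by omega), ?_, ?_⟩
      · by_cases hqm : q - min I.card s ≤ m
        · simp only [hwS, hwT]
          rw [hmin, hQc]
          rw [hminFI] at hact
          have key := choose_mul_choose_le_add (m := m) (a := u - min I.card s - D.card)
            (b := q - min I.card s) (L := min I.card s + D.card - s) (by omega) (by omega)
          have ea : u - min I.card s - D.card + (min I.card s + D.card - s) = u - s := by omega
          have eb : q - min I.card s + (min I.card s + D.card - s) = q - (s - D.card) := by omega
          rw [ea, eb] at key
          exact key
        · rw [hwS0 hqm]; exact Nat.zero_le _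
      · simp only [hΦ]
        have hFU : F \ (I ∪ D) = (F \ I) \ D := by
          ext x; simp only [mem_sdiff, mem_union]; tauto
        have hFUc : (F \ (I ∪ D)).card = (F \ I).card - D.card := by
          rw [hFU, card_sdiff_of_subset hDFI]
        rw [if_neg (by omega), if_neg (by omega), if_neg (by rw [hFUc, Finset.sdiff_sdiff_eq_self hDK']; omega),
          Finset.sdiff_sdiff_eq_self hDK', union_sdiff_cancel_right hdisj]
    · -- (L1)
      have hDne : D.Nonempty := nonempty_iff_ne_empty.2 h2
      have hDpos : 0 < D.card := card_pos.2 hDne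
      have hFIs : (F \ I).card ≤ s := by omega
      have hKeq : J₀ (F \ I) = F \ I :=
        eq_of_subset_of_card_le hK.1 (by rw [hK.2]; omega)
      have hQc : ((F \ I) \ D).card = (F \ I).card - D.card := card_sdiff_of_subset hDFI
      have hminFI : min (F \ I).card s = (F \ I).card := min_eq_left hFIs
      refine ⟨hslot _ _ sdiff_subset (by rw [hKeq]; exact sdiff_subset) (by omega) (by omega), ?_, ?_⟩
      · by_cases hqm : q - min I.card s ≤ m
        · simp only [hwS, hwT]
          rw [hminFI, hQc]
          rw [hminFI] at hact
          have key := choose_mul_choose_le_add (m := m) (a := u - min I.card s - D.card)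
            (b := q - min I.card s) (L := min I.card s - ((F \ I).card - D.card)) (by omega) (by omega)
          have ea : u - min I.card s - D.card + (min I.card s - ((F \ I).card - D.card)) = u - (F \ I).card := by
            omega
          have eb : q - min I.card s + (min I.card s - ((F \ I).card - D.card)) = q - ((F \ I).card - D.card) := by
            omega
          rw [ea, eb] at key
          exact key
        · rw [hwS0 hqm]; exact Nat.zero_le _
      · simp only [hΦ]
        rw [if_pos hFIs, Finset.sdiff_sdiff_eq_self hDFI, if_neg h4, hFFI]
  have hinj : Set.InjOn Ψ (SRC : Set (Finset α × Finset α)) := by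
    intro σ₁ hσ₁ σ₂ hσ₂ heq
    rw [← (hmaps σ₁ hσ₁).2.2, ← (hmaps σ₂ hσ₂).2.2, heq]
  calc ∑ σ ∈ SRC, wS σ ≤ ∑ σ ∈ SRC, wT (Ψ σ) := sum_le_sum (fun σ hσ => (hmaps σ hσ).2.1)
    _ = ∑ τ ∈ SRC.image Ψ, wT τ := (sum_image hinj).symm
    _ ≤ ∑ τ ∈ SLOT, wT τ := by
        apply sum_le_sum_of_subset_of_nonneg
        · intro τ hτ
          rw [mem_image] at hτ
          obtain ⟨σ, hσ, rfl⟩ := hτ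
          exact (hmaps σ hσ).1
        · intro _ _ _; exact Nat.zero_le _


/-- **THE ARITHMETIC CORE OF EVERY ROW `(q,u)` ON `U_{s,k} ⊕ U_{m,m}`** (`rows_arith`, NIGHT3-G25-GRADED.md (I) in type-count form):
`Σ_i C(k,i)·[min(i,s) ≤ q ∧ u ≤ p_i]·C(m, q−min(i,s))·C(p_i, u−q) ≤ C(u,q)·Σ_j C(k,j)·[min(j,s) ≤ u]·C(m, u−min(j,s))`,
`p_i = min(k−i,s) + (m − (q − min(i,s)))` — for every `k, s, m` and `q ≤ u`. -/
theorem rows_arith (k s m q u : ℕ) (hqu : q ≤ u) :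
    ∑ i ∈ range (k + 1), k.choose i * (if min i s ≤ q ∧ u ≤ min (k - i) s + (m - (q - min i s)) then
        m.choose (q - min i s) * (min (k - i) s + (m - (q - min i s))).choose (u - q) else 0) ≤
      u.choose q * ∑ j ∈ range (k + 1), k.choose j * (if min j s ≤ u then m.choose (u - min j s) else 0) := by
  classical
  have hex : ∀ J : Finset (Fin k), ∃ K : Finset (Fin k), K ⊆ J ∧ K.card = min J.card s :=
    fun J => Finset.exists_subset_card_eq (min_le_left _ _)
  choose J₀ hJ₀ using hex
  have h1 := sum_sources_eq (univ : Finset (Fin k)) s m q u hqu J₀ hJ₀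
  have h2 := sum_slots_eq (univ : Finset (Fin k)) s m q u J₀ hJ₀
  have h3 := sources_le_slots (univ : Finset (Fin k)) s m q u hqu J₀ hJ₀
  rw [card_univ, Fintype.card_fin] at h1 h2
  rw [← h1, ← h2]
  exact h3

end OneFlat

end PercRepro
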